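import Summits.QuantumFields.YangMills.Theorems.BalabanUVNodesN12FarDatumSurgery
import Summits.QuantumFields.YangMills.Theorems.BalabanUVNodesN12GaugeLetterLocExplicit
import HarnessLib

/-!
# DAG node N12 [B15] — THE (σ)_N LETTER OF RECORD WITH ONE DATUM LETTER ON `Z^{(k)}`: `N12GaugeLetterLocExplicit.exists_gaugeLetterLoc_atRecord_explicit` with the region ∕ shadow
# rows `𝒞 hD N hGN hN1 hGmem` REPLACED by «the `k`-datum is `ρn`-flat on the `k`-bonds inside `Z^{(k)}`» — by far-datum surgery

Cell `pub-ymgap` (HUMAN RULINGS D-0062 ∕ D-0149), width seat `pub-ymgap-dag-n12-w6` g18.  Key K1⁹ `stmt-QuantumFields-27364`, `--kind proof --supports … --as helper`;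
count-neutral; THEOREMS ONLY (0 `def`, 0 `instance`, 0 `sorry`).  Consumed BY NAME, nothing modified: dag-n12-w3 g4's explicit (σ)_N capstone
`N12GaugeLetterLocExplicit.exists_gaugeLetterLoc_atRecord_explicit` (run at `N = 𝒞 = univ` for the LOCALISED datum) and `N12FarDatumSurgery.exists_isMinimizer_surgery_far`.

WHY (cell bus 2026-08-29, ⚑ LOCATED-DATUM-FAR; the lane's ⚑ LOCATED-GAUGE-ORBIT of the same hour).  The explicit letter's datum hypothesis `hD : ∀ c ∈ 𝒞, dist1 (W c) ≤ ρn` with the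
geometry row `hGmem` (every face-crossing member's `k`-shadow lies in `𝒞`; at level `0` the members are ALL fine bonds meeting `Ω₁(Z)ᶜ ⊇ Zᶜ`) makes `𝒞` reach arbitrarily far off
`Z`, where the knit's datum `ext V_k = V_k` is a bare large-field variable: uninhabitable «for every base field of the guard», gauge-invariantly (one `k`-bond `= −1` between two
blocks off `Z`).  The variational problem does not read the datum there (`…N12FarDatumSurgery`): running the letter at the LOCALISED datum `W′ := W` on `Z^{(k)}`, `1` off it,
and at the surgered minimiser `U′` (`= U₀` on the fine bonds inside `Z`) gives the SAME residual gauge clause and the SAME bounds for `U₀` itself on the plaquettes meeting an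
`Ω₁(Z)`-sourced bond and on the inputs inside `Z` — these bonds lie inside `Z` (collar `L·M₁ − 1 ≥ 3`), where `U′ = U₀`.

[Balaban1988Convergent] = «[III]», (2.2) p. 255, (2.10)–(2.13) pp. 256–257, (1.3) p. 246; [Balaban1985Variational] = «[15]», (2)–(4) p. 278, Thm 1 p. 279, (16)–(18) p. 280;
[Balaban1985RegularSpaces] (1.7), (1.19) pp. 77–79; [Balaban1985Averaging] Prop. 2 (52)–(53) p. 26.

CONTENTS (namespace `Summit.QuantumFields.YangMills.BalabanUVNodes.N12GaugeLetterLocExplicitOnZ`).  §1 `corners_mem_of_sourced` (the C1 plaquettes lie inside `Z`); §2 ★★★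
`exists_gaugeLetterLoc_atRecord_explicit_onZ`.

HONEST FRAMING.  Composition by name + lattice bookkeeping; the datum letter on `Z^{(k)}` REMAINS a gauge condition on the base field (inhabited along the lane's orbit road —
normalising gauge of `B15Prop1DatumGaugeNormalisation` §7 for box-shaped `Z^{(k)} ∖ Λ̄`, LOCATED-GEOM v3 scope for ring-like `Z`); nothing of Bałaban's estimates asserted or refuted;
count-neutral helper; N12 NOT discharged; K1⁹ NOT closed; counts unmoved; one finite 𝕋⁴ programme at fixed ε — R4 closes the conditional rung `BalabanLadder.UV` only; NOT continuum ∕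
OS ∕ mass gap ∕ Clay.
-/

noncomputable section

open scoped Matrix.Norms.L2Operator BigOperators

namespace Summit.QuantumFields.YangMills.BalabanUVNodes.N12GaugeLetterLocExplicitOnZ

open Set
open Literature.MathematicalPhysics.QuantumFieldTheory.Balaban1983to89
open T4Continuum GaugeField B15DeterminingSets BlockAveraging
open T4CubeChartGnomonic (SU2)
open B16Sect1Backgrounds (toMS)
open B14.Eq213MaximalDomains (side)
open B14.Eq213DetSet (Bj maxDomT)
open B14.Eq216Concrete (inputs)
open B14.Eq22Determines (blockIter IsBlockUnion)
open B14DomainGeom (Pt Within)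
open B15Eq112TorusCover (cover)
open B10StarCount (unshift_shift)
open ExpMeanLog (deltaSU)
open Literature.MathematicalPhysics.QuantumFieldTheory.BalabanImbrieJaffe1984to88.BIJ85Eq453GaugeField (qsstarGIter0)
open Summit.QuantumFields.YangMills.BalabanUVNodes.N12FarDatumSurgeryPrelim (near_of_mem_maxDomT near_shift near_unshift near_mono mem_of_near margin_le)
open Summit.QuantumFields.YangMills.BalabanUVNodes.N12FarDatumSurgery (exists_isMinimizer_surgery_far)
open Summit.QuantumFields.YangMills.BalabanUVNodes.N12GaugeLetterLocExplicit (exists_gaugeLetterLoc_atRecord_explicit)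

variable {F : T4Family} {Kt k : ℕ} {ν : Node00.Stage7Numerics} {Z : Set (Site (F.P Kt) 0)}

/-! ## §1  The plaquettes meeting an `Ω₁(Z)`-sourced bond lie inside `Z` -/

/-- ★ **THE C1 PLAQUETTES LIE INSIDE `Z`**: if one of the four bonds of a fine plaquette has its source in `Ω₁(Z)`, all four corners (the fourth in both step orders) lie in `Z` — they are within three unit steps of that
source and the collar of `Ω₁(Z)` inside `Z` is `L·M₁ − 1 ≥ 3` ([III] (2.13), `M₁ ≥ 4`). [cite: Balaban1988Convergent, (2.13) pp.256–257] -/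
theorem corners_mem_of_sourced (hM4 : 4 ≤ ν.M₁) (hk1 : 1 ≤ k) (hdiv : side (F.P Kt).L ν.M₁ k ∣ (F.P Kt).sitesPerDir 0) (p : Plaq (F.P Kt) 0)
    (hp : ((⟨p.src, p.μ⟩ : PBond (F.P Kt) 0) ∈ {b : PBond (F.P Kt) 0 | b.src ∈ maxDomT ν.M₁ Z 1} ∨
            (⟨p.src.shift p.μ, p.ν⟩ : PBond (F.P Kt) 0) ∈ {b : PBond (F.P Kt) 0 | b.src ∈ maxDomT ν.M₁ Z 1} ∨
            (⟨p.src.shift p.ν, p.μ⟩ : PBond (F.P Kt) 0) ∈ {b : PBond (F.P Kt) 0 | b.src ∈ maxDomT ν.M₁ Z 1} ∨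
            (⟨p.src, p.ν⟩ : PBond (F.P Kt) 0) ∈ {b : PBond (F.P Kt) 0 | b.src ∈ maxDomT ν.M₁ Z 1})) :
    p.src ∈ Z ∧ p.src.shift p.μ ∈ Z ∧ p.src.shift p.ν ∈ Z ∧ (p.src.shift p.μ).shift p.ν ∈ Z ∧ (p.src.shift p.ν).shift p.μ ∈ Z := by
  have hM : 1 ≤ ν.M₁ := le_trans (by norm_num) hM4
  have hm := margin_le (F := F) (Kt := Kt) hM4
  -- `p.src` is within one backward step of a point of `Ω₁`
  have hsrc : ∃ z₁ z : Pt (F.P Kt).d, cover (F.P Kt) z₁ ∈ maxDomT ν.M₁ Z 1 ∧ cover (F.P Kt) z = p.src ∧ Within (0 + 1) z₁ z := by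
    rcases hp with h | h | h | h
    · exact near_mono (by norm_num) (near_of_mem_maxDomT (Z := Z) hM le_rfl h)
    · have := near_unshift (near_of_mem_maxDomT (Z := Z) hM le_rfl h) p.μ
      rwa [show (p.src.shift p.μ).unshift p.μ = p.src from unshift_shift _ _] at this
    · have := near_unshift (near_of_mem_maxDomT (Z := Z) hM le_rfl h) p.ν
      rwa [show (p.src.shift p.ν).unshift p.ν = p.src from unshift_shift _ _] at this
    · exact near_mono (by norm_num) (near_of_mem_maxDomT (Z := Z) hM le_rfl h)
  exact ⟨mem_of_near hM hk1 hdiv (by linarith) hsrc, mem_of_near hM hk1 hdiv (by linarith) (near_shift hsrc p.μ),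
    mem_of_near hM hk1 hdiv (by linarith) (near_shift hsrc p.ν), mem_of_near hM hk1 hdiv (by linarith) (near_shift (near_shift hsrc p.μ) p.ν),
    mem_of_near hM hk1 hdiv (by linarith) (near_shift (near_shift hsrc p.ν) p.μ)⟩

/-! ## §2  The (σ)_N letter of record with the datum letter on `Z^{(k)}` -/

/-- ★★★ **THE (σ)_N LETTER OF RECORD, EXPLICIT, CLASS EDITION, DATUM LETTER ON `Z^{(k)}` ONLY** — `N12GaugeLetterLocExplicit.exists_gaugeLetterLoc_atRecord_explicit` with its six region ∕
shadow binders `𝒞 hD N hGN hN1 hGmem` replaced by ONE letter `hDZ` («the `k`-datum is `ρn`-flat on the `k`-bonds with both ends in `Z^{(k)}`») and `hZblk` (`Z` a union of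
`k`-blocks, the record's shape); same level guard ∕ radii ∕ support numerics, same class numerics, SAME residual clause and SAME tolerance in the plaquette clause; the input
clause is stated for the inputs with both ends in `Z`.  PROOF: far-datum surgery (`W′ := W` on `Z^{(k)}`, `1` off it — `ρn`-flat EVERYWHERE; `U′` the surgered minimiser of
`N12FarDatumSurgery.exists_isMinimizer_surgery_far`), the explicit letter at `N = 𝒞 = univ`, and `U′ = U₀` on the bonds the clauses speak about (§1).
[cite: Balaban1985Variational, (2)–(4) p.278, Thm 1 p.279, (16)–(18) p.280; Balaban1985RegularSpaces, (1.7) p.77, (1.19) p.79; Balaban1985Averaging, Prop. 2 (52)–(53) p.26; Balaban1988Convergent, (2.2) p.255, (2.10)–(2.13) pp.256–257, (1.3) p.246] -/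
theorem exists_gaugeLetterLoc_atRecord_explicit_onZ (ν : Node00.Stage7Numerics) (Kt : ℕ) {k : ℕ} (hk0 : 0 < k) (hk : k ≤ (F.P Kt).m + (F.P Kt).K)
    (hdiv : side (F.P Kt).L ν.M₁ k ∣ (F.P Kt).sitesPerDir 0) (Z : Set (Site (F.P Kt) 0)) (hZblk : IsBlockUnion k Z)
    -- NUMERICS (i): a level guard `k + c ≤ m + K` with `4d + m′ + 3 < 2·L^c` (no wrapping), and `M₁ ≥ (4d + m′)·L² + 2d·L + 12` (radii), `m′ = 3·(d·((L−1)∕2)) + 5`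
    {c : ℕ} (hkc : k + c ≤ (F.P Kt).m + (F.P Kt).K) (hc : 4 * (F.P Kt).d + (3 * ((F.P Kt).d * (((F.P Kt).L - 1) / 2)) + 5) + 3 < 2 * (F.P Kt).L ^ c)
    (hMrad : (4 * (F.P Kt).d + (3 * ((F.P Kt).d * (((F.P Kt).L - 1) / 2)) + 5)) * (F.P Kt).L ^ 2 + 2 * (F.P Kt).d * (F.P Kt).L + 12 ≤ ν.M₁)
    -- THE DATUM LETTER ON `Z^{(k)}` and the minimiser
    {ρn : ℝ} (hρn : 0 ≤ ρn)
    (W : GaugeField (F.P Kt) k SU2) (hDZ : ∀ e : PBond (F.P Kt) k, e.src ∈ pts k Z → e.tgt ∈ pts k Z → dist1 (W e) ≤ ρn)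
    {U₀ : GaugeField (F.P Kt) 0 SU2}
    (hmin : IsMinimizer (Node00.avOfRecord F 2 Kt) (Node00.regMSCoPOfRecord F 2 ν Kt k (maxDomT ν.M₁ Z)) (Bj ν.M₁ Z k)
      (avgFamily (Node00.avOfRecord F 2 Kt) (qsstarGIter0 k W)) U₀)
    -- the class threshold `εreg`: positive and small ([Balaban1985Averaging] Prop. 2's smallness at `α₀ := εreg·L²`)
    (hεpos : 0 < ν.εreg)
    (hα3 : (143 * (((((F.P Kt).d + 4 : ℕ) : ℝ)) ^ 2 / 4) ^ 2) * (ν.εreg * (F.P Kt).L ^ 2) ≤ 1 / 3)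
    (hα2 : 2 * (ν.εreg * (F.P Kt).L ^ 2) ≤ 2 * deltaSU (Fin 2) / ((((F.P Kt).d + 4) * (F.P Kt).L : ℕ) : ℝ) ^ 2)
    (haN : (((((F.P Kt).d + 2) * (F.P Kt).L : ℕ) : ℝ) ^ 2 / 4) * (2 * (ν.εreg * (F.P Kt).L ^ 2)) < deltaSU (Fin 2))
    -- the family's support numerics: `M₁ ≥ ((d+4)L + 6)·L²`
    (hM₁ : (((F.P Kt).d + 4) * (F.P Kt).L + 6) * (F.P Kt).L ^ 2 ≤ ν.M₁) :
    ∃ σ : GaugeTransf (F.P Kt) 0 SU2,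
      (∀ j, j ≤ k → ∀ b ∈ bondsOf (Bj ν.M₁ Z k j), toMS σ j b.src = 1 ∧ toMS σ j b.tgt = 1) ∧
        (∀ p : Plaq (F.P Kt) 0, ((⟨p.src, p.μ⟩ : PBond (F.P Kt) 0) ∈ {b : PBond (F.P Kt) 0 | b.src ∈ maxDomT ν.M₁ Z 1} ∨
            (⟨p.src.shift p.μ, p.ν⟩ : PBond (F.P Kt) 0) ∈ {b : PBond (F.P Kt) 0 | b.src ∈ maxDomT ν.M₁ Z 1} ∨
            (⟨p.src.shift p.ν, p.μ⟩ : PBond (F.P Kt) 0) ∈ {b : PBond (F.P Kt) 0 | b.src ∈ maxDomT ν.M₁ Z 1} ∨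
            (⟨p.src, p.ν⟩ : PBond (F.P Kt) 0) ∈ {b : PBond (F.P Kt) 0 | b.src ∈ maxDomT ν.M₁ Z 1}) →
          ‖((gaugeAct σ U₀ ⟨p.src, p.μ⟩ : SU2) : Matrix (Fin 2) (Fin 2) ℂ) - 1‖ ≤
              max ρn ((((2 * (∑ i ∈ Finset.range (k + 1), ((F.P Kt).d * (((F.P Kt).L ^ i - 1) / 2) + 1)) + 1 +
                  (3 * ((F.P Kt).d * (((F.P Kt).L - 1) / 2)) + 5) * (F.P Kt).L ^ k : ℕ) : ℝ)) ^ 2 / 4 * (ν.εreg * (F.P Kt).eta 0 ^ 2) +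
                ((3 * ((F.P Kt).d * (((F.P Kt).L - 1) / 2)) + 5 : ℕ) : ℝ) * (6 * ((((((F.P Kt).d + 2) * (F.P Kt).L : ℕ) : ℝ) ^ 2 / 4) * (2 * (ν.εreg * (F.P Kt).L ^ 2))) * ∑ i ∈ Finset.range k, ((F.P Kt).L : ℝ) ^ i) + ((3 * ((F.P Kt).d * (((F.P Kt).L - 1) / 2)) + 5 : ℕ) : ℝ) * ρn) ∧
            ‖((gaugeAct σ U₀ ⟨p.src.shift p.μ, p.ν⟩ : SU2) : Matrix (Fin 2) (Fin 2) ℂ) - 1‖ ≤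
              max ρn ((((2 * (∑ i ∈ Finset.range (k + 1), ((F.P Kt).d * (((F.P Kt).L ^ i - 1) / 2) + 1)) + 1 +
                  (3 * ((F.P Kt).d * (((F.P Kt).L - 1) / 2)) + 5) * (F.P Kt).L ^ k : ℕ) : ℝ)) ^ 2 / 4 * (ν.εreg * (F.P Kt).eta 0 ^ 2) +
                ((3 * ((F.P Kt).d * (((F.P Kt).L - 1) / 2)) + 5 : ℕ) : ℝ) * (6 * ((((((F.P Kt).d + 2) * (F.P Kt).L : ℕ) : ℝ) ^ 2 / 4) * (2 * (ν.εreg * (F.P Kt).L ^ 2))) * ∑ i ∈ Finset.range k, ((F.P Kt).L : ℝ) ^ i) + ((3 * ((F.P Kt).d * (((F.P Kt).L - 1) / 2)) + 5 : ℕ) : ℝ) * ρn) ∧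
            ‖((gaugeAct σ U₀ ⟨p.src.shift p.ν, p.μ⟩ : SU2) : Matrix (Fin 2) (Fin 2) ℂ) - 1‖ ≤
              max ρn ((((2 * (∑ i ∈ Finset.range (k + 1), ((F.P Kt).d * (((F.P Kt).L ^ i - 1) / 2) + 1)) + 1 +
                  (3 * ((F.P Kt).d * (((F.P Kt).L - 1) / 2)) + 5) * (F.P Kt).L ^ k : ℕ) : ℝ)) ^ 2 / 4 * (ν.εreg * (F.P Kt).eta 0 ^ 2) +
                ((3 * ((F.P Kt).d * (((F.P Kt).L - 1) / 2)) + 5 : ℕ) : ℝ) * (6 * ((((((F.P Kt).d + 2) * (F.P Kt).L : ℕ) : ℝ) ^ 2 / 4) * (2 * (ν.εreg * (F.P Kt).L ^ 2))) * ∑ i ∈ Finset.range k, ((F.P Kt).L : ℝ) ^ i) + ((3 * ((F.P Kt).d * (((F.P Kt).L - 1) / 2)) + 5 : ℕ) : ℝ) * ρn) ∧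
            ‖((gaugeAct σ U₀ ⟨p.src, p.ν⟩ : SU2) : Matrix (Fin 2) (Fin 2) ℂ) - 1‖ ≤
              max ρn ((((2 * (∑ i ∈ Finset.range (k + 1), ((F.P Kt).d * (((F.P Kt).L ^ i - 1) / 2) + 1)) + 1 +
                  (3 * ((F.P Kt).d * (((F.P Kt).L - 1) / 2)) + 5) * (F.P Kt).L ^ k : ℕ) : ℝ)) ^ 2 / 4 * (ν.εreg * (F.P Kt).eta 0 ^ 2) +
                ((3 * ((F.P Kt).d * (((F.P Kt).L - 1) / 2)) + 5 : ℕ) : ℝ) * (6 * ((((((F.P Kt).d + 2) * (F.P Kt).L : ℕ) : ℝ) ^ 2 / 4) * (2 * (ν.εreg * (F.P Kt).L ^ 2))) * ∑ i ∈ Finset.range k, ((F.P Kt).L : ℝ) ^ i) + ((3 * ((F.P Kt).d * (((F.P Kt).L - 1) / 2)) + 5 : ℕ) : ℝ) * ρn)) ∧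
        (∀ b ∈ inputs (Bj ν.M₁ Z k), b.src ∈ Z → b.tgt ∈ Z →
          ‖((gaugeAct σ U₀ b : SU2) : Matrix (Fin 2) (Fin 2) ℂ) - 1‖ ≤
              max ρn ((((2 * (∑ i ∈ Finset.range (k + 1), ((F.P Kt).d * (((F.P Kt).L ^ i - 1) / 2) + 1)) + 1 +
                  (3 * ((F.P Kt).d * (((F.P Kt).L - 1) / 2)) + 5) * (F.P Kt).L ^ k : ℕ) : ℝ)) ^ 2 / 4 * (ν.εreg * (F.P Kt).eta 0 ^ 2) +
                ((3 * ((F.P Kt).d * (((F.P Kt).L - 1) / 2)) + 5 : ℕ) : ℝ) * (6 * ((((((F.P Kt).d + 2) * (F.P Kt).L : ℕ) : ℝ) ^ 2 / 4) * (2 * (ν.εreg * (F.P Kt).L ^ 2))) * ∑ i ∈ Finset.range k, ((F.P Kt).L : ℝ) ^ i) + ((3 * ((F.P Kt).d * (((F.P Kt).L - 1) / 2)) + 5 : ℕ) : ℝ) * ρn)) := by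
  classical
  -- `M₁ ≥ 4` from the radii numerics
  have hM4 : 4 ≤ ν.M₁ := le_trans (by omega) hMrad
  -- the localised datum: `W` on `Z^{(k)}`, `1` off it — `ρn`-flat everywhere
  obtain ⟨W', hWW', hW'⟩ : ∃ W' : GaugeField (F.P Kt) k SU2, (∀ e : PBond (F.P Kt) k, e.src ∈ pts k Z → e.tgt ∈ pts k Z → W' e = W e) ∧
      ∀ e : PBond (F.P Kt) k, dist1 (W' e) ≤ ρn :=
    ⟨fun e => if e.src ∈ pts k Z ∧ e.tgt ∈ pts k Z then W e else 1, fun e hs ht => if_pos ⟨hs, ht⟩, fun e => by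
      show dist1 (if e.src ∈ pts k Z ∧ e.tgt ∈ pts k Z then W e else 1) ≤ ρn
      by_cases h : e.src ∈ pts k Z ∧ e.tgt ∈ pts k Z
      · rw [if_pos h]; exact hDZ e h.1 h.2
      · rw [if_neg h, GaugeGroup.dist1_one]; exact hρn⟩
  -- the surgered minimiser for the localised datum
  obtain ⟨U', hin, hmin'⟩ := exists_isMinimizer_surgery_far (N := 2) hM4 hk0 hk hdiv hZblk hWW' hmin
  -- the explicit letter of record at `N = 𝒞 = univ`
  obtain ⟨σ, hσ, hC1, hCin⟩ := exists_gaugeLetterLoc_atRecord_explicit ν Kt hk0 hk hdiv Z hkc hc hMrad hρn W' (univ : Set (PBond (F.P Kt) k))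
    (fun e _ => hW' e) hmin' (univ : Set (PBond (F.P Kt) 0)) (fun _ _ _ _ => mem_univ _) (fun _ _ => ⟨mem_univ _, mem_univ _, mem_univ _, mem_univ _⟩)
    hεpos hα3 hα2 haN hM₁ (fun _ _ _ _ _ => mem_univ _)
  -- back to `U₀` on the bonds inside `Z`
  have hback : ∀ b : PBond (F.P Kt) 0, b.src ∈ Z → b.tgt ∈ Z → gaugeAct σ U' b = gaugeAct σ U₀ b := fun b hs ht => by
    show σ b.src * U' b * (σ b.tgt)⁻¹ = σ b.src * U₀ b * (σ b.tgt)⁻¹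
    rw [hin b hs ht]
  refine ⟨σ, hσ, fun p hp => ?_, fun b hb hs ht => ?_⟩
  · obtain ⟨h1, h2, h3, h4, h4'⟩ := corners_mem_of_sourced (Z := Z) hM4 hk0 hdiv p hp
    obtain ⟨c1, c2, c3, c4⟩ := hC1 p hp
    rw [hback ⟨p.src, p.μ⟩ h1 h2] at c1
    rw [hback ⟨p.src.shift p.μ, p.ν⟩ h2 h4] at c2
    rw [hback ⟨p.src.shift p.ν, p.μ⟩ h3 h4'] at c3
    rw [hback ⟨p.src, p.ν⟩ h1 h3] at c4
    exact ⟨c1, c2, c3, c4⟩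
  · have := hCin b hb (mem_univ _)
    rwa [hback b hs ht] at this

end Summit.QuantumFields.YangMills.BalabanUVNodes.N12GaugeLetterLocExplicitOnZ

end
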